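import Summits.HodgeConjecture.HodgeConjecture.Theorems.Ring2AbelianAllStandardAPencilsKleimanSquare
import Summits.HodgeConjecture.HodgeConjecture.Theorems.Ring2AbelianAllStandardAPencilsHomNumIff
import Summits.HodgeConjecture.HodgeConjecture.Theorems.Ring2AbelianAllAndreLiebermanDischargedRows
import Summits.HodgeConjecture.HodgeConjecture.Theorems.Ring2AbelianAllAndreStandardALieberman
import HarnessLib

/-!
# §AbelianAll, André axis — part XIV-g: Milne's node `D(𝒳 × 𝒳)` on the SQUARES of the total spaces of the compact abelian pencils, typed, placed, and its rows closed in kernel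

research route, not a corollary; conditional on HC_CM plus one named minimal statement.
research route conditional on HC_CM; not a corollary; Q11.4-sentence-2 already refuted in dim ≥ 3.

Seat `pub-hodge-ring2-ab-andre-1` (gen 52), cell AbelianAll of RING 2; a SERVICE file `--supports
stmt-HodgeConjecture-16267` (`RankFourFaces.CMToAbelian`): nothing here closes that item, no case of the Hodge
conjecture and no standard conjecture is proved, and no statement below is claimed minimal or strictly weaker than
another. Every named fact is a displayed BINDER (`h₂₁ = andre1996_cmAnchoredPencil`, André 1996 Lemme 6.3.1;
`h₂₂ = andre1996_cmHodgeClasses_algebraicallyAnchoredPencils`, Lemmes 6.3.2–6.3.3); `HC_CM = RankFourFaces.CMAbelianHodge`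
is a binder; Abdulali's (1.1) and Lieberman's `B(A)` enter only through seat ab-andre-2's kernel theorems
(`abdulali1994_holds`, part XXII-d), BY NAME.

## What is typed here, and why only now

Milne (*Grothendieck's standard conjecture of Lefschetz type over finite fields*, arXiv:2011.06563, §6.1) records:
Prop. 6.1 "Conjecture `D(X)` implies `A(X, L)` (all `L`); in the presence of the Hodge standard conjecture,
`A(X, L)` (one `L`) implies `D(X)`"; Cor. 6.2 "Conjecture `D(X × X)` implies `B(X)`" (proof: "`A(X × X, L ⊗ 1 + 1 ⊗ L)`
implies `B(X)`", Kleiman's Thm. 4-1); and Rem. 6.3: "If Conjecture `D(X × X)` holds whenever `X` is an abelian scheme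
over a complete smooth curve over `ℂ`, then the Hodge conjecture holds for abelian varieties." André 1996, Appendice
(p. 44): "Les implications `N ⇒ B ⇒ G` sont dues à Grothendieck; pour cela, le carré de `X` suffit dans `N`"
(`N` = numerical ≡ homological equivalence). On the tree's real carriers (`complexBetti`, `algebraicClasses`,
`cupProduct`, André's sign-free `StandardConjectureBStar`) the edge `A(X × X, η ⊠ 1 + 1 ⊠ η) ⇒ B⋆(X)` did not exist
before part XIV-f (`standardConjectureBStar_of_standardConjectureA_tensor_self`, Kleiman 1968 Thm. 2.9 ported), so
Milne's Remark 6.3 was a print node with no typed edge into the census. This file types it and closes its rows: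

* §1 (one variety, real carriers). `D(X × X) ⊗ ℂ ⟹ B⋆(X, η)` for every `η` (Milne Cor. 6.2;
  `standardConjectureBStar_of_nondegenerate_tensor_self`: part XIV-e's `A ⟺ D` on `X ⊗ X`, b05's
  `isPolarizationClass_boxSum`, part XIV-f); hence `A(X, η)` for every polarisation class and `D(X) ⊗ ℂ`. ON PATH with
  NO named fact: `HC(X × X) ⟹ D(X × X) ⊗ ℂ` is part XIV-e's `nondegenerate_algebraicClasses_of_hodgeConjectureFor` on
  `X ⊗ X`. Composed (`HC(X × X) ⇒ D(X × X) ⇒ A(X × X) ⇒ B⋆(X)`, Kleiman's route) the two give exactly the content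
  of the tree's already-discharged Literature fact `Kleiman1968_lefschetzInvolution_algebraic_of_hodgeClasses_prod`
  (`…_holds` in `Literature/…/LefschetzStandardOfHodgeConjectureSquare.lean`, Voisin's `γ_k` argument); that statement
  is NOT restated here (gate dedup; count once) — use the Literature theorem by name.
* §2 (the node). `CompactAbelianPencilSquareStandardD` (Sq∀): two-sided `hom ≡ num ⊗ ℂ` in all codimensions on
  `𝒳 × 𝒳` for the total space `𝒳` of EVERY compact pencil of abelian varieties — Milne's hypothesis verbatim, on the
  carriers; `CMPointedPencilSquareStandardD` (Sq^CM): the same for the pencils with a CM fibre only (André's Lemme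
  6.3.1 (ii) pencils are such). Edges, all kernel and fact-free: Sq∀ ⟹ (5∀) `CompactAbelianPencilLefschetz`,
  Sq^CM ⟹ (5) `CMPointedPencilLefschetz`, hence Sq ⟹ A_pen ⟺ D_pen (parts XIV, XIV-e); `HodgeConjecture ⟹ Sq∀`
  (on path, no fact); Sq∀ ⟺ "`A(𝒳 × 𝒳, θ)` for every polarisation class `θ` of the square" (Milne Prop. 6.1 in
  characteristic `0`). Rungs: `d ≤ 1` PROVED fact-free (`dim 𝒳 × 𝒳 ≤ 4`, part XIV-c's `standardConjectureA_of_dim_le_four`);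
  the first open rung `d = 2` is ONE clause — on the sixfold `𝒳 × 𝒳` of a compact pencil of abelian SURFACES, an
  element of `N⁴ H⁸` cup-orthogonal to `N² H⁴` is zero — and it implies the `B`-rung `(5∀)₂`, which the tree otherwise
  has only from the named fact `Tankeev2011_lefschetzStandard_abelianSurfacePencil` (part X).
* §3 (rows). `h₂₁ → HC_CM → Sq^CM → HC_AV`; `h₂₁ → h₂₂ → Sq∀ → HC_AV` (kind 1, no `HC_CM`) and `… → HC_AV ∧ HC_CM`;
  the item reading `h₂₁ → Sq^CM → CMToAbelian`. These are Milne's Remark 6.3 in kernel form modulo the displayed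
  André binders (Milne's own route goes through his Thm. 4 = André's §6.3 deformation argument, i.e. exactly `h₂₁`/`h₂₂`).

## Placement (honest)

In print Sq∀ and the `B`-node (5∀) are EQUIVALENT: `B(𝒳) ⇒ B(𝒳 × 𝒳)` (stability of `B` under products, Kleiman 1968
§2) `⇒ A(𝒳 × 𝒳) ⇒ D(𝒳 × 𝒳)` in characteristic `0`. Only Sq ⟹ (5) is typed: the converse needs exterior products of
ALGEBRAIC CORRESPONDENCES on the carriers (`Λ_𝒳 ⊠ 1 + 1 ⊠ Λ_𝒳` as an algebraic class on `(𝒳 × 𝒳)²`; b05's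
`exists_kunnethLowering` gives the linear operator only), which the tree does not have. So the census order is
Sq∀ ⟹ (5∀) ⟹ A_pen∀ ⟺ D_pen∀ and Sq^CM ⟹ (5) ⟹ A_pen^CM, no converse claimed; Sq is OPEN for `d ≥ 2`.
NOT claimed minimal, NOT claimed strictly weaker or stronger than any census node beyond the typed arrows.

References: [Milne2020LefschetzStandardFiniteFields] §6.1 Prop. 6.1, Cor. 6.2, Rem. 6.3; [Andre1996Motifs] §1.3
(p. 12), Lemme 6.3.1 (p. 31), §6.3 Remarque 2 (p. 33), Appendice (p. 44); [Kleiman1968AlgebraicCycles] Thm. 2.9, §3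
Thm. 3.5, Prop. 3.8, Cor. 3.9; [Kleiman1994StandardConjectures] Thm. 4-1; [Grothendieck1968] §3 p. 196;
[Abdulali1994FamiliesAV] p. 1122; [Tankeev2011, main theorem]; [Lieberman1968, main theorem].
-/

set_option linter.dupNamespace false

namespace Summit.HodgeConjecture.HodgeConjecture.Ring2.AbelianAll

open CategoryTheory AlgebraicGeometry MonoidalCategory
open Literature.AlgebraicGeometry Literature.AlgebraicGeometry.Motives
open Literature.AlgebraicGeometry.HodgeTheory
open Literature.AlgebraicTopology.SingularHomology Literature.Geometry.Kaehler
open Literature.AlgebraicGeometry.Milne1999 (IsOfCMType)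
open Literature.AlgebraicGeometry.Andre1996 (andre1996_cmAnchoredPencil andre1996_cmHodgeClasses_algebraicallyAnchoredPencils)
open Summit.HodgeConjecture.HodgeConjecture
open Summit.HodgeConjecture.HodgeConjecture.Theses
open Summit.HodgeConjecture.HodgeConjecture.Theorems

/-! ## §1 One variety: `D(X × X) ⊗ ℂ ⟹ B⋆(X)`, `⟹ A(X)`, `⟹ D(X)`; `HC(X × X) ⟹ D(X × X) ⊗ ℂ` fact-free -/

section RealCarriers

variable {n : ℕ} {X : SchemeOver ℂ}

/-- **MILNE COR. 6.2 / ANDRÉ "le carré de `X` suffit" ON THE REAL CARRIERS: `D(X × X) ⊗ ℂ ⟹ B⋆(X, η)` for every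
`η`.** For `X` smooth complex projective of dimension `n`: if for all `p + q = 2n` the cup pairing
`Nᵖ H²ᵖ((X × X)(ℂ); ℂ) × N^q H^{2q}((X × X)(ℂ); ℂ) → H⁴ⁿ` on the `ℂ`-spans of the algebraic classes of `X × X` is
non-degenerate on both sides, then André's `*_{L,η}` is an algebraic correspondence in every degree, for every
`η ∈ H²(X(ℂ); ℂ)` (vacuous unless `η` is a polarisation class). Proof: `D ⇒ A` on `X ⊗ X` for the polarisation class
`η ⊠ 1 + 1 ⊠ η` (part XIV-e `standardConjectureA_forall_iff_nondegenerate`, b05 `isPolarizationClass_boxSum`), then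
Kleiman's `A(X × X) ⇒ B⋆(X)` (part XIV-f `standardConjectureBStar_of_standardConjectureA_tensor_self`). Both sides OPEN
in general; an implication, nothing asserted. [cite: Milne2020LefschetzStandardFiniteFields, §6.1 Prop. 6.1 and Cor. 6.2]
[cite: Andre1996Motifs, Appendice (p. 44)] [cite: Kleiman1968AlgebraicCycles, Thm. 2.9 and §3 Thm. 3.5]
[cite: Kleiman1994StandardConjectures, Thm. 4-1] -/
theorem standardConjectureBStar_of_nondegenerate_tensor_self (hX : IsSmoothProjective n X)
    (hD : ∀ (p q : ℕ) (hpq : p + q = n + n),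
      (∀ ξ ∈ algebraicClasses (X ⊗ X) p,
          (∀ b ∈ algebraicClasses (X ⊗ X) q, cupProduct (show 2 * p + 2 * q = 2 * (n + n) by omega) ξ b = 0) →
            ξ = 0) ∧
        (∀ b ∈ algebraicClasses (X ⊗ X) q,
          (∀ ξ ∈ algebraicClasses (X ⊗ X) p, cupProduct (show 2 * p + 2 * q = 2 * (n + n) by omega) ξ b = 0) →
            b = 0))
    (η : complexBetti X 2) : StandardConjectureBStar n X η := fun hη ↦
  standardConjectureBStar_of_standardConjectureA_tensor_self hX hη
    ((standardConjectureA_forall_iff_nondegenerate (hX.tensor_holds hX)).2 hD _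
      (isPolarizationClass_boxSum hX hX hη hη)) hη

/-- **`D(X × X) ⊗ ℂ ⟹ A(X, η)` for every polarisation class `η`** (through `B⋆(X)` and Grothendieck's `B ⇒ A` on one
variety, part XIV `standardConjectureA_of_standardConjectureBStar`). [cite: Milne2020LefschetzStandardFiniteFields, §6.1 Cor. 6.2]
[cite: Grothendieck1968, §3 p. 196 (B(X) ⇒ A(X))] -/
theorem forall_standardConjectureA_of_nondegenerate_tensor_self (hX : IsSmoothProjective n X)
    (hD : ∀ (p q : ℕ) (hpq : p + q = n + n),
      (∀ ξ ∈ algebraicClasses (X ⊗ X) p,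
          (∀ b ∈ algebraicClasses (X ⊗ X) q, cupProduct (show 2 * p + 2 * q = 2 * (n + n) by omega) ξ b = 0) →
            ξ = 0) ∧
        (∀ b ∈ algebraicClasses (X ⊗ X) q,
          (∀ ξ ∈ algebraicClasses (X ⊗ X) p, cupProduct (show 2 * p + 2 * q = 2 * (n + n) by omega) ξ b = 0) →
            b = 0))
    (η : complexBetti X 2) (hη : IsPolarizationClass n X η) : StandardConjectureA n X η :=
  standardConjectureA_of_standardConjectureBStar hX hη (standardConjectureBStar_of_nondegenerate_tensor_self hX hD η)

/-- **`D(X × X) ⊗ ℂ ⟹ D(X) ⊗ ℂ`** (two-sided non-degeneracy of `Nᵖ × N^q → H²ⁿ` on `X` itself, all `p + q = n`), through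
`A(X, η)` for all `η` and part XIV-e's `A ⟺ D`. (In print this is immediate from `X ↪ X × X` as a factor; here it is
routed through the letters already typed.) [cite: Kleiman1968AlgebraicCycles, §3 Thm. 3.5, Prop. 3.8, Cor. 3.9]
[cite: Milne2020LefschetzStandardFiniteFields, §6.1 Prop. 6.1] -/
theorem nondegenerate_of_nondegenerate_tensor_self (hX : IsSmoothProjective n X)
    (hD : ∀ (p q : ℕ) (hpq : p + q = n + n),
      (∀ ξ ∈ algebraicClasses (X ⊗ X) p,
          (∀ b ∈ algebraicClasses (X ⊗ X) q, cupProduct (show 2 * p + 2 * q = 2 * (n + n) by omega) ξ b = 0) →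
            ξ = 0) ∧
        (∀ b ∈ algebraicClasses (X ⊗ X) q,
          (∀ ξ ∈ algebraicClasses (X ⊗ X) p, cupProduct (show 2 * p + 2 * q = 2 * (n + n) by omega) ξ b = 0) →
            b = 0))
    {p q : ℕ} (hpq : p + q = n) :
    (∀ ξ ∈ algebraicClasses X p,
        (∀ b ∈ algebraicClasses X q, cupProduct (show 2 * p + 2 * q = 2 * n by omega) ξ b = 0) → ξ = 0) ∧
      (∀ b ∈ algebraicClasses X q,
        (∀ ξ ∈ algebraicClasses X p, cupProduct (show 2 * p + 2 * q = 2 * n by omega) ξ b = 0) → b = 0) :=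
  (standardConjectureA_forall_iff_nondegenerate hX).1 (forall_standardConjectureA_of_nondegenerate_tensor_self hX hD)
    p q hpq

/-- **ON PATH, FACT-FREE: `HC(X × X) ⟹ D(X × X) ⊗ ℂ`** — part XIV-e's `nondegenerate_algebraicClasses_of_hodgeConjectureFor`
(Hodge–Riemann on the algebraic classes, seat ab-andre-2's part XVIII-b) applied to the `2n`-fold `X ⊗ X`
(`IsSmoothProjective.tensor_holds`). No named fact. [cite: Kleiman1968AlgebraicCycles, §3] [cite: Lieberman1968, main theorem] -/
theorem nondegenerate_tensor_self_of_hodgeConjectureFor (hX : IsSmoothProjective n X)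
    (h : HodgeConjectureFor (n + n) (X ⊗ X)) {p q : ℕ} (hpq : p + q = n + n) :
    (∀ ξ ∈ algebraicClasses (X ⊗ X) p,
        (∀ b ∈ algebraicClasses (X ⊗ X) q, cupProduct (show 2 * p + 2 * q = 2 * (n + n) by omega) ξ b = 0) →
          ξ = 0) ∧
      (∀ b ∈ algebraicClasses (X ⊗ X) q,
        (∀ ξ ∈ algebraicClasses (X ⊗ X) p, cupProduct (show 2 * p + 2 * q = 2 * (n + n) by omega) ξ b = 0) →
          b = 0) :=
  nondegenerate_algebraicClasses_of_hodgeConjectureFor (hX.tensor_holds hX) h hpq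

end RealCarriers

/-! ## §2 The node: `D(𝒳 × 𝒳)` for the total spaces of the compact abelian pencils (Milne 2020, Rem. 6.3) -/

/-- **`D` ON THE SQUARES OF THE COMPACT ABELIAN PENCIL TOTAL SPACES** (Sq∀; Milne's Remark 6.3 hypothesis "Conjecture
`D(X × X)` whenever `X` is an abelian scheme over a complete smooth curve over `ℂ`", on the carriers and complexified):
for every compact pencil `f : 𝒳 ⟶ S` of abelian `d`-folds (total space of dimension `d + 1`) and all `p + q = 2d + 2`,
the cup pairing `Nᵖ H²ᵖ((𝒳 × 𝒳)(ℂ); ℂ) × N^q H^{2q}((𝒳 × 𝒳)(ℂ); ℂ) → H^{4d+4}` on the `ℂ`-spans of the algebraic classes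
of `𝒳 × 𝒳` is non-degenerate on both sides (numerical ≡ homological equivalence `⊗ ℂ` on `𝒳 × 𝒳`). OPEN for `d ≥ 2`
(`d ≤ 1` is a theorem below); implies André's `⋆_L`-node (5∀) and hence `A_pen∀`, `D_pen∀` (this file); implied by
the Hodge conjecture with no named fact (this file); equivalent to (5∀) in print (stability of `B` under products, NOT
typed). Not claimed minimal, nor strictly weaker or stronger than any census node beyond the typed arrows. A HYPOTHESIS
wherever used. [cite: Milne2020LefschetzStandardFiniteFields, §6.1 Rem. 6.3] [cite: Andre1996Motifs, §6.3 Remarque 2 (p. 33) and Appendice (p. 44)]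
[cite: Grothendieck1968, §3 p. 196 (D(X))] -/
@[conjecture] def CompactAbelianPencilSquareStandardD : Prop :=
  ∀ ⦃d : ℕ⦄ ⦃𝒳 S : SchemeOver ℂ⦄ (f : 𝒳 ⟶ S), IsCompactAbelianPencil f d →
    ∀ (p q : ℕ) (hpq : p + q = (d + 1) + (d + 1)),
      (∀ ξ ∈ algebraicClasses (𝒳 ⊗ 𝒳) p,
          (∀ b ∈ algebraicClasses (𝒳 ⊗ 𝒳) q,
              cupProduct (show 2 * p + 2 * q = 2 * ((d + 1) + (d + 1)) by omega) ξ b = 0) → ξ = 0) ∧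
        (∀ b ∈ algebraicClasses (𝒳 ⊗ 𝒳) q,
          (∀ ξ ∈ algebraicClasses (𝒳 ⊗ 𝒳) p,
              cupProduct (show 2 * p + 2 * q = 2 * ((d + 1) + (d + 1)) by omega) ξ b = 0) → b = 0)

/-- **`D` ON THE SQUARES OF THE CM-POINTED COMPACT ABELIAN PENCIL TOTAL SPACES** (Sq^CM): the same, asked only of the
compact abelian pencils possessing a fibre `𝒳_t ≅ A₀.X` with `A₀` of CM type (the pencils of André's Lemme 6.3.1 (ii)).
OPEN for `d ≥ 2`; implied by Sq∀; implies (5) `CMPointedPencilLefschetz` and `A_pen^CM`; with `HC_CM` and André's Lemme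
6.3.1 it gives `HC_AV` (§3). Not claimed minimal, nor strictly weaker than (5). A HYPOTHESIS wherever used.
[cite: Milne2020LefschetzStandardFiniteFields, §6.1 Rem. 6.3] [cite: Andre1996Motifs, Lemme 6.3.1 (ii) (p. 31)] -/
@[conjecture] def CMPointedPencilSquareStandardD : Prop :=
  ∀ ⦃d : ℕ⦄ ⦃𝒳 S : SchemeOver ℂ⦄ (f : 𝒳 ⟶ S), IsCompactAbelianPencil f d →
    (∃ (t : ComplexPoints S) (A₀ : AbelianVariety ℂ), Nonempty (A₀.X ≅ fiberOver f t) ∧ IsOfCMType A₀) →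
      ∀ (p q : ℕ) (hpq : p + q = (d + 1) + (d + 1)),
        (∀ ξ ∈ algebraicClasses (𝒳 ⊗ 𝒳) p,
            (∀ b ∈ algebraicClasses (𝒳 ⊗ 𝒳) q,
                cupProduct (show 2 * p + 2 * q = 2 * ((d + 1) + (d + 1)) by omega) ξ b = 0) → ξ = 0) ∧
          (∀ b ∈ algebraicClasses (𝒳 ⊗ 𝒳) q,
            (∀ ξ ∈ algebraicClasses (𝒳 ⊗ 𝒳) p,
                cupProduct (show 2 * p + 2 * q = 2 * ((d + 1) + (d + 1)) by omega) ξ b = 0) → b = 0)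

/-- Sq∀ ⟹ Sq^CM (drop the CM-point hypothesis). [folklore] -/
theorem cmPointedPencilSquareStandardD_of_compact (hSq : CompactAbelianPencilSquareStandardD) :
    CMPointedPencilSquareStandardD :=
  fun _ _ _ f hf _ ↦ hSq f hf

/-- **Sq∀ ⟹ (5∀)**: `D(𝒳 × 𝒳) ⊗ ℂ` on every compact total space gives André's `⋆_L`-node `CompactAbelianPencilLefschetz`
(§1 on `X := 𝒳`, dimension `d + 1`). Kernel, fact-free; the converse (true in print) is NOT typed.
[cite: Milne2020LefschetzStandardFiniteFields, §6.1 Cor. 6.2] [cite: Andre1996Motifs, Appendice (p. 44)] -/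
theorem compactAbelianPencilLefschetz_of_squareStandardD (hSq : CompactAbelianPencilSquareStandardD) :
    CompactAbelianPencilLefschetz :=
  fun _ _ _ f hf η ↦ standardConjectureBStar_of_nondegenerate_tensor_self hf.isSmoothProjective_total (hSq f hf) η

/-- **Sq^CM ⟹ (5)**: the same on the CM-pointed compact pencils (`CMPointedPencilLefschetz`, part I). Kernel, fact-free.
[cite: Milne2020LefschetzStandardFiniteFields, §6.1 Cor. 6.2] [cite: Andre1996Motifs, Lemme 6.3.1 (ii) (p. 31)] -/
theorem cmPointedPencilLefschetz_of_squareStandardD (hSq : CMPointedPencilSquareStandardD) : CMPointedPencilLefschetz :=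
  fun _ _ _ f hf hCM η ↦
    standardConjectureBStar_of_nondegenerate_tensor_self hf.isSmoothProjective_total (hSq f hf hCM) η

/-- Sq∀ ⟹ A_pen∀ (through (5∀) and Grothendieck's `B ⇒ A`, part XIV). [cite: Grothendieck1968, §3 p. 196 (B(X) ⇒ A(X))] -/
theorem compactAbelianPencilStandardA_of_squareStandardD (hSq : CompactAbelianPencilSquareStandardD) :
    CompactAbelianPencilStandardA :=
  compactAbelianPencilStandardA_of_compactAbelianPencilLefschetz (compactAbelianPencilLefschetz_of_squareStandardD hSq)

/-- Sq^CM ⟹ A_pen^CM (through (5), part XIV). [cite: Grothendieck1968, §3 p. 196 (B(X) ⇒ A(X))] -/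
theorem cmPointedPencilStandardA_of_squareStandardD (hSq : CMPointedPencilSquareStandardD) : CMPointedPencilStandardA :=
  cmPointedPencilStandardA_of_cmPointedPencilLefschetz (cmPointedPencilLefschetz_of_squareStandardD hSq)

/-- Sq∀ ⟹ D_pen∀: `D(𝒳 × 𝒳) ⊗ ℂ ⟹ D(𝒳) ⊗ ℂ` on every compact total space (part XIV-e
`nondegenerateCompactPencil_of_compactAbelianPencilLefschetz`). [cite: Kleiman1968AlgebraicCycles, §3 Cor. 3.9] -/
theorem nondegenerateCompactPencil_of_squareStandardD (hSq : CompactAbelianPencilSquareStandardD) {d : ℕ}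
    {𝒳 S : SchemeOver ℂ} {f : 𝒳 ⟶ S} (hf : IsCompactAbelianPencil f d) {p q : ℕ} (hpq : p + q = d + 1) :
    (∀ ξ ∈ algebraicClasses 𝒳 p,
        (∀ b ∈ algebraicClasses 𝒳 q, cupProduct (show 2 * p + 2 * q = 2 * (d + 1) by omega) ξ b = 0) → ξ = 0) ∧
      (∀ b ∈ algebraicClasses 𝒳 q,
        (∀ ξ ∈ algebraicClasses 𝒳 p, cupProduct (show 2 * p + 2 * q = 2 * (d + 1) by omega) ξ b = 0) → b = 0) :=
  nondegenerateCompactPencil_of_compactAbelianPencilLefschetz (compactAbelianPencilLefschetz_of_squareStandardD hSq) hf hpq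

/-- **Sq∀ ⟺ `A(𝒳 × 𝒳, θ)` for every polarisation class `θ` of the square, every compact abelian pencil** (Milne's
Prop. 6.1 in characteristic `0`, on the carriers: part XIV-e `standardConjectureA_forall_iff_nondegenerate` on `𝒳 ⊗ 𝒳`).
Fact-free; both sides OPEN. [cite: Milne2020LefschetzStandardFiniteFields, §6.1 Prop. 6.1] [cite: Kleiman1968AlgebraicCycles, §3 Thm. 3.5 and Cor. 3.9] -/
theorem compactAbelianPencilSquareStandardD_iff_standardConjectureA_square :
    CompactAbelianPencilSquareStandardD ↔
      ∀ ⦃d : ℕ⦄ ⦃𝒳 S : SchemeOver ℂ⦄ (f : 𝒳 ⟶ S), IsCompactAbelianPencil f d →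
        ∀ θ : complexBetti (𝒳 ⊗ 𝒳) 2, IsPolarizationClass ((d + 1) + (d + 1)) (𝒳 ⊗ 𝒳) θ →
          StandardConjectureA ((d + 1) + (d + 1)) (𝒳 ⊗ 𝒳) θ :=
  ⟨fun hSq _ _ _ f hf ↦
      (standardConjectureA_forall_iff_nondegenerate
        (hf.isSmoothProjective_total.tensor_holds hf.isSmoothProjective_total)).2 (hSq f hf),
    fun hA _ _ _ f hf ↦
      (standardConjectureA_forall_iff_nondegenerate
        (hf.isSmoothProjective_total.tensor_holds hf.isSmoothProjective_total)).1 (hA f hf)⟩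

/-- **ON PATH (C6), FACT-FREE: `HodgeConjecture ⟹ Sq∀`** — the Hodge conjecture for the `(2d+2)`-fold `𝒳 × 𝒳` itself
gives `D(𝒳 × 𝒳) ⊗ ℂ` (§1). Contrast part I's on-path lemma for (5∀), which displays the Kleiman/Voisin fact `hK` (now
itself a theorem of the tree). [cite: Kleiman1968AlgebraicCycles, §3] [cite: Lieberman1968, main theorem] -/
theorem compactAbelianPencilSquareStandardD_of_hodgeConjecture (h : _root_.HodgeConjecture) :
    CompactAbelianPencilSquareStandardD := fun _ _ _ _ hf _ _ hpq ↦
  nondegenerate_tensor_self_of_hodgeConjectureFor hf.isSmoothProjective_total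
    (h (hf.isSmoothProjective_total.tensor_holds hf.isSmoothProjective_total)) hpq

/-- ON PATH (C6), fact-free: `HodgeConjecture ⟹ Sq^CM`. [folklore] -/
theorem cmPointedPencilSquareStandardD_of_hodgeConjecture (h : _root_.HodgeConjecture) :
    CMPointedPencilSquareStandardD :=
  cmPointedPencilSquareStandardD_of_compact (compactAbelianPencilSquareStandardD_of_hodgeConjecture h)

/-- **THE RUNGS `d ≤ 1` OF Sq ARE THEOREMS, fact-free**: for a compact pencil of elliptic curves (or `d = 0`) the square
`𝒳 × 𝒳` has dimension `2d + 2 ≤ 4`, where `A(Y, θ)` holds for every polarisation class (part XIV-c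
`standardConjectureA_of_dim_le_four`: Lefschetz `(1,1)` and hard Lefschetz), hence `D(𝒳 × 𝒳) ⊗ ℂ` (part XIV-e).
[cite: Lieberman1968, Introduction (dim ≤ 4)] [cite: Kleiman1968AlgebraicCycles, §3 Cor. 3.9] -/
theorem squareStandardD_of_isCompactAbelianPencil_of_le_one {d : ℕ} (hd : d ≤ 1) {𝒳 S : SchemeOver ℂ} {f : 𝒳 ⟶ S}
    (hf : IsCompactAbelianPencil f d) (p q : ℕ) (hpq : p + q = (d + 1) + (d + 1)) :
    (∀ ξ ∈ algebraicClasses (𝒳 ⊗ 𝒳) p,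
        (∀ b ∈ algebraicClasses (𝒳 ⊗ 𝒳) q,
            cupProduct (show 2 * p + 2 * q = 2 * ((d + 1) + (d + 1)) by omega) ξ b = 0) → ξ = 0) ∧
      (∀ b ∈ algebraicClasses (𝒳 ⊗ 𝒳) q,
        (∀ ξ ∈ algebraicClasses (𝒳 ⊗ 𝒳) p,
            cupProduct (show 2 * p + 2 * q = 2 * ((d + 1) + (d + 1)) by omega) ξ b = 0) → b = 0) :=
  have hXX := hf.isSmoothProjective_total.tensor_holds hf.isSmoothProjective_total
  (standardConjectureA_forall_iff_nondegenerate hXX).1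
    (fun _ hθ ↦ standardConjectureA_of_dim_le_four (by omega) hXX hθ) p q hpq

/-- **THE FIRST OPEN RUNG `d = 2` AS ONE CLAUSE, AND WHAT IT BUYS**: if on the sixfold `𝒳 × 𝒳` of every compact pencil
of abelian SURFACES every element of `N⁴ H⁸((𝒳 × 𝒳)(ℂ); ℂ)` (span of the algebraic surface classes of the sixfold)
cup-orthogonal to `N² H⁴` is zero — the single instance `(p, q) = (2, 4)` of one-sided `hom ≡ num` above the middle,
all other instances being unconditional (part XIV-d `standardConjectureA_of_homNum`) — then `(5∀)₂`: `B⋆` for the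
threefold total spaces of all compact abelian-surface pencils. The tree has `(5∀)₂` otherwise only from the named fact
`Tankeev2011_lefschetzStandard_abelianSurfacePencil` (part X); this is a fact-free SUFFICIENT condition, OPEN, nothing
asserted. [cite: Kleiman1968AlgebraicCycles, Thm. 2.9 and §3 Thm. 3.5] [cite: Tankeev2011, main theorem]
[cite: Milne2020LefschetzStandardFiniteFields, §6.1 Cor. 6.2] -/
theorem lefschetzBCompactPencilsAtRelDim_two_of_homNum_square
    (hD : ∀ ⦃𝒳 S : SchemeOver ℂ⦄ (f : 𝒳 ⟶ S), IsCompactAbelianPencil f 2 →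
      ∀ y ∈ algebraicClasses (𝒳 ⊗ 𝒳) 4,
        (∀ x ∈ algebraicClasses (𝒳 ⊗ 𝒳) 2,
            cupProduct (show 2 * 2 + 2 * 4 = 2 * ((2 + 1) + (2 + 1)) by omega) x y = 0) → y = 0) :
    LefschetzBCompactPencilsAtRelDim 2 := fun _ _ f hf η hη ↦ by
  have hX := hf.isSmoothProjective_total
  have hXX := hX.tensor_holds hX
  refine standardConjectureBStar_of_standardConjectureA_tensor_self hX hη
    (standardConjectureA_of_homNum hXX (isPolarizationClass_boxSum hX hX hη hη) fun p q hpq hp hlt ↦ ?_) hη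
  obtain rfl : p = 2 := by omega
  obtain rfl : q = 4 := by omega
  exact hD f hf

/-! ## §3 The rows: Milne's Remark 6.3 in kernel form, modulo the displayed André binders -/

/-- **`h₂₁ → HC_CM → Sq^CM → HC_AV`**: granted André's Lemme 6.3.1 (`h₂₁`, a BINDER) and the Hodge conjecture for CM
abelian varieties (`HC_CM`, a BINDER), `D ⊗ ℂ` on the squares of the total spaces of the CM-pointed compact abelian pencils
gives the Hodge conjecture for all complex abelian varieties: Sq^CM ⟹ (5) (§2) and seat ab-andre-2's binder-free row
`HC_AV_of_HC_CM_of_lefschetzBCMPointedPencils` (part XXII-d: Abdulali's (1.1) and Lieberman's `B(A)` are kernel theorems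
there). research route, not a corollary; conditional on HC_CM plus one named minimal statement.
[cite: Milne2020LefschetzStandardFiniteFields, §6.1 Rem. 6.3] [cite: Andre1996Motifs, Lemme 6.3.1 (p. 31) and §6.3 Remarque 2 (p. 33)]
[cite: Abdulali1994FamiliesAV, p. 1122] -/
theorem HC_AV_of_HC_CM_of_cmPointedPencilSquareStandardD (h₂₁ : andre1996_cmAnchoredPencil)
    (hCM : RankFourFaces.CMAbelianHodge) (hSq : CMPointedPencilSquareStandardD) :
    PadicSemiregularLift.HodgeAbelianVarieties :=
  HC_AV_of_HC_CM_of_lefschetzBCMPointedPencils h₂₁ hCM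
    (lefschetzBCMPointedPencils_iff_cmPointedPencilLefschetz.2 (cmPointedPencilLefschetz_of_squareStandardD hSq))

/-- The item reading: granted `h₂₁` only, `Sq^CM ⟹ CMToAbelian` (stmt-HodgeConjecture-16267); nothing closes the item.
[cite: Milne2020LefschetzStandardFiniteFields, §6.1 Rem. 6.3] [cite: Andre1996Motifs, Remarque 2 (p. 33)] -/
theorem cmToAbelian_of_andre1996_of_cmPointedPencilSquareStandardD (h₂₁ : andre1996_cmAnchoredPencil)
    (hSq : CMPointedPencilSquareStandardD) : RankFourFaces.CMToAbelian :=
  fun hCM A _ ↦ HC_AV_of_HC_CM_of_cmPointedPencilSquareStandardD h₂₁ hCM hSq A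

/-- **KIND 1, no `HC_CM`: `h₂₁ → h₂₂ → Sq∀ → HC_AV`** — Milne's Remark 6.3 as he routes it (his Thm. 4 = André's §6.3
for compact pencils, i.e. the binders `h₂₁`, `h₂₂`): `D ⊗ ℂ` on the squares of ALL compact abelian pencil total spaces
gives the Hodge conjecture for abelian varieties, via Sq∀ ⟹ (5∀) (§2) and seat ab-andre-2's binder-free
`HC_AV_of_andre1996_of_lefschetzBCompactPencils` (part XXII-d). Named facts as binders; no case of HC proved.
[cite: Milne2020LefschetzStandardFiniteFields, §6.1 Rem. 6.3] [cite: Andre1996Motifs, §6.3 Remarque 2 (p. 33)]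
[cite: Milne2020HodgeClassesAV, Thm. 4 (p. 8)] -/
theorem HC_AV_of_andre1996_of_compactAbelianPencilSquareStandardD (h₂₁ : andre1996_cmAnchoredPencil)
    (h₂₂ : andre1996_cmHodgeClasses_algebraicallyAnchoredPencils) (hSq : CompactAbelianPencilSquareStandardD) :
    PadicSemiregularLift.HodgeAbelianVarieties :=
  HC_AV_of_andre1996_of_lefschetzBCompactPencils h₂₁ h₂₂
    (lefschetzBCompactPencils_iff_compactAbelianPencilLefschetz.2 (compactAbelianPencilLefschetz_of_squareStandardD hSq))

/-- **`h₂₁ → h₂₂ → Sq∀ → HC_AV ∧ HC_CM`** (the pair, through `A_pen∀` and part XIV-b's row with Abdulali's `A`-form fact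
supplied by seat ab-andre-2's `abdulali1994A_holds`). Named facts as binders; no case of HC proved.
[cite: Milne2020LefschetzStandardFiniteFields, §6.1 Rem. 6.3] [cite: Andre1996Motifs, Lemme 6.3.1 (p. 31) and §6.3 (p. 33)]
[cite: Abdulali1994FamiliesAV, p. 1122] -/
theorem HC_AV_and_HC_CM_of_andre1996_of_compactAbelianPencilSquareStandardD (h₂₁ : andre1996_cmAnchoredPencil)
    (h₂₂ : andre1996_cmHodgeClasses_algebraicallyAnchoredPencils) (hSq : CompactAbelianPencilSquareStandardD) :
    PadicSemiregularLift.HodgeAbelianVarieties ∧ RankFourFaces.CMAbelianHodge :=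
  HC_AV_and_HC_CM_of_abdulaliA_of_andre1996_of_compactAbelianPencilStandardA abdulali1994A_holds h₂₁ h₂₂
    (compactAbelianPencilStandardA_of_squareStandardD hSq)

/-- ON-PATH summary: under the Hodge conjecture both square nodes hold, with NO named fact (so the rows above are
consistent with the conjecture they serve). [folklore] -/
theorem squareStandardDNodes_of_hodgeConjecture (h : _root_.HodgeConjecture) :
    CompactAbelianPencilSquareStandardD ∧ CMPointedPencilSquareStandardD :=
  ⟨compactAbelianPencilSquareStandardD_of_hodgeConjecture h, cmPointedPencilSquareStandardD_of_hodgeConjecture h⟩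

end Summit.HodgeConjecture.HodgeConjecture.Ring2.AbelianAll
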